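import Literature.Topology.FourManifolds.BoundaryGluingConstruction
import Literature.Topology.FourManifolds.GluingConstructionMaps
import Summits.SmoothPoincare4.SmoothPoincare4.Theorems.ConvexBisectionAcyclicBisectionExistsSplitComplementPushforward
import HarnessLib

/-!
# The complement piece `W₂`, I: the signed seam level of Milnor's gluing `M' = X ∪_Ψ W`
(helper file 1 of the wave-4 brick T3b (iii) "the complement piece `W₂ = {Φ ≤ 0}` of the pushed
prefix sub-handlebody inside Milnor's gluing" for stub `stub_steinRealisation` (NF6), line
`modp-braid-orbits` r11, crux `ConvexBisection.AcyclicBisectionExists`, item stmt-SmoothPoincare4-10508;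
lead c5, worker Y6)

Milnor's explicit gluing `P = G.d₂.Glued` of two compact manifolds with boundary `M`, `N` along
`φ : ∂M ≅ ∂N` (`BoundaryGluingConstruction.lean`: the three open pieces `∂M × ℝ`, `M - ∂M`,
`N - ∂N` glued along the long open collars `G.CM`, `G.CN`) carries a smooth **signed seam level**
`seamLevelFn G : P → ℝ`:

* on the seam piece `ι (z, t) = d₂.inl (d₁.inl (z, t))` it is the signed height profile of the seam
  coordinate `t` (`signedHeightProfile`, `= t` for `|t| ≤ ½`, `= ±1` for `|t| ≥ ¾`);
* on `j_M (M)` it is the collar-height function of `G.CM` (`CollarHeightFunction.lean`), `≥ 0`,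
  vanishing exactly on `∂M`; on `j_N (N)` it is minus the collar-height function of `G.CN`.

So `{seamLevelFn ≥ 0} = j_M (M)`, `{seamLevelFn ≤ 0} = j_N (N)`, the zero set is the seam
`ι (∂M × {0})`, and the seam is a REGULAR level (`not_isMCriticalPt_seamLevelFn`: along the seam
lines `t ↦ ι (z, t)` the function is the identity near `t = 0`).  This is the function `Φ₀` of the
level function `Φ = (1 - Σ Ωⱼ) Φ₀ + Σ Ωⱼ (Hⱼ ∘ Ξⱼ⁻¹)` presenting the complement piece `W₂` of the
pushed prefix sub-handlebody as a regular sublevel set (V5-REPORT §3.2; files II–IV of this brick).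
Milnor, *Lectures on the h-cobordism theorem* (1965), Thm. 1.4 (the gluing) and Thm. 3.1 of
*Morse theory* (1963) (regular levels).  Everything here is proved; no named facts.

## References
* J. Milnor, *Lectures on the h-cobordism theorem* (1965), §1, Thm. 1.4. [MilnorHCobordism1965]
* J. Milnor, *Morse theory* (1963), §2–§3, Thm. 3.1. [Milnor1963]
* T. Bröcker, K. Jänich, *Introduction to Differential Topology* (1982), (13.6), (13.11). [BrockerJanich1982]
-/

noncomputable section

-- the prescribed namespace `Summit.<P>.<Sub>.…` duplicates `SmoothPoincare4` (P = Sub)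
set_option linter.dupNamespace false

open scoped Manifold ContDiff Topology

namespace Summit.SmoothPoincare4.SmoothPoincare4.Theorems.AcyclicBisectionExists.ModpBraidOrbits

open Set Function Filter
open Literature.Topology.FourManifolds

/-! ### §1 The signed height profile -/

section Profile

/-- **The signed height profile** `t ↦ ψ t - ψ (-t) - t` (`ψ = heightProfile`): the odd extension of
the collar-height profile, `= ψ t` for `t ≥ 0`, `= -ψ (-t)` for `t ≤ 0`, the identity on `[-½, ½]`,
`±1` beyond `±¾`. [cite: BrockerJanich1982, (13.6)] -/
def signedHeightProfile (t : ℝ) : ℝ := heightProfile t - heightProfile (-t) - t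

/-- The signed profile is smooth. [folklore] -/
theorem contDiff_signedHeightProfile : ContDiff ℝ ∞ signedHeightProfile :=
  (contDiff_heightProfile.sub (contDiff_heightProfile.comp contDiff_neg)).sub contDiff_id

/-- For `t ≥ 0` the signed profile is the profile. [folklore] -/
theorem signedHeightProfile_of_nonneg {t : ℝ} (ht : 0 ≤ t) : signedHeightProfile t = heightProfile t := by
  unfold signedHeightProfile
  rw [heightProfile_of_le (show -t ≤ 2⁻¹ by linarith)]
  ring

/-- For `t ≤ 0` the signed profile is minus the profile of `-t`. [folklore] -/
theorem signedHeightProfile_of_nonpos {t : ℝ} (ht : t ≤ 0) :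
    signedHeightProfile t = -heightProfile (-t) := by
  unfold signedHeightProfile
  rw [heightProfile_of_le (show t ≤ 2⁻¹ by linarith)]
  ring

/-- On `[-½, ½]` the signed profile is the identity. [folklore] -/
theorem signedHeightProfile_of_abs_le {t : ℝ} (ht : |t| ≤ 2⁻¹) : signedHeightProfile t = t := by
  rw [abs_le] at ht
  unfold signedHeightProfile
  rw [heightProfile_of_le ht.2, heightProfile_of_le (by linarith)]
  ring

/-- The profile is positive on `(0, ∞)`. [folklore] -/
theorem heightProfile_pos {t : ℝ} (ht : 0 < t) : 0 < heightProfile t := by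
  have h0 : 0 ≤ heightStep t := Real.smoothTransition.nonneg _
  have h1 : heightStep t ≤ 1 := Real.smoothTransition.le_one _
  unfold heightProfile
  rcases h1.lt_or_eq with h1 | h1
  · nlinarith [mul_pos (sub_pos.2 h1) ht]
  · rw [h1]; norm_num

/-- The profile is nonnegative on `[0, ∞)`. [folklore] -/
theorem heightProfile_nonneg {t : ℝ} (ht : 0 ≤ t) : 0 ≤ heightProfile t := by
  rcases ht.lt_or_eq with ht | rfl
  · exact (heightProfile_pos ht).le
  · rw [heightProfile_of_le (by norm_num)]

/-- The signed profile is positive on `(0, ∞)`. [folklore] -/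
theorem signedHeightProfile_pos {t : ℝ} (ht : 0 < t) : 0 < signedHeightProfile t := by
  rw [signedHeightProfile_of_nonneg ht.le]
  exact heightProfile_pos ht

/-- The signed profile is negative on `(-∞, 0)`. [folklore] -/
theorem signedHeightProfile_neg {t : ℝ} (ht : t < 0) : signedHeightProfile t < 0 := by
  rw [signedHeightProfile_of_nonpos ht.le, neg_lt_zero]
  exact heightProfile_pos (by linarith)

/-- The signed profile vanishes exactly at `0`. [folklore] -/
theorem signedHeightProfile_eq_zero_iff {t : ℝ} : signedHeightProfile t = 0 ↔ t = 0 := by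
  constructor
  · intro h
    rcases lt_trichotomy t 0 with ht | ht | ht
    · exact absurd h (signedHeightProfile_neg ht).ne
    · exact ht
    · exact absurd h (signedHeightProfile_pos ht).ne'
  · rintro rfl
    exact signedHeightProfile_of_abs_le (by norm_num)

/-- The signed profile is nonnegative exactly on `[0, ∞)`. [folklore] -/
theorem signedHeightProfile_nonneg_iff {t : ℝ} : 0 ≤ signedHeightProfile t ↔ 0 ≤ t := by
  constructor
  · intro h
    by_contra ht
    exact absurd h (not_le.2 (signedHeightProfile_neg (not_le.1 ht)))
  · intro ht
    rcases ht.lt_or_eq with ht | rfl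
    · exact (signedHeightProfile_pos ht).le
    · rw [signedHeightProfile_eq_zero_iff.2 rfl]

/-- The signed profile is nonpositive exactly on `(-∞, 0]`. [folklore] -/
theorem signedHeightProfile_nonpos_iff {t : ℝ} : signedHeightProfile t ≤ 0 ↔ t ≤ 0 := by
  constructor
  · intro h
    by_contra ht
    exact absurd h (not_le.2 (signedHeightProfile_pos (not_le.1 ht)))
  · intro ht
    rcases ht.lt_or_eq with ht | rfl
    · exact (signedHeightProfile_neg ht).le
    · rw [signedHeightProfile_eq_zero_iff.2 rfl]

/-- **`0` is a regular point of the signed profile** (it is the identity near `0`). [folklore] -/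
theorem not_isMCriticalPt_signedHeightProfile_zero : ¬ IsMCriticalPt 𝓘(ℝ, ℝ) signedHeightProfile 0 := by
  unfold IsMCriticalPt
  rw [mfderiv_eq_fderiv]
  have hev : signedHeightProfile =ᶠ[𝓝 (0 : ℝ)] id := by
    filter_upwards [Metric.ball_mem_nhds (0 : ℝ) (by norm_num : (0 : ℝ) < 2⁻¹)] with t ht
    exact signedHeightProfile_of_abs_le (by rw [Metric.mem_ball, dist_zero_right] at ht; exact ht.le)
  rw [hev.fderiv_eq, fderiv_id]
  intro h
  have h1 : (1 : ℝ) = 0 := ContinuousLinearMap.ext_iff.1 h 1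
  exact one_ne_zero h1

end Profile

/-! ### §2 The collar-height function: sign -/

section Height

variable {n : ℕ} {M : Type} [TopologicalSpace M] [ChartedSpace (EuclideanHalfSpace (n + 1)) M]
  {b : BoundaryData (𝓡∂ (n + 1)) M (𝓡 n)} (C : b.OpenCollar)

/-- The collar-height function is nonnegative. [folklore] -/
theorem collarHeightFn_nonneg' (z : M) : 0 ≤ C.collarHeightFn z := by
  by_cases hz : z ∈ C.region
  · rw [C.collarHeightFn_of_mem hz]
    exact heightProfile_nonneg (C.height_nonneg z hz)
  · rw [C.collarHeightFn_of_not_mem hz]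
    exact zero_le_one

/-- The collar-height function vanishes exactly on the boundary. [folklore] -/
theorem collarHeightFn_eq_zero_iff' (z : M) : C.collarHeightFn z = 0 ↔ ∃ x, b.incl x = z := by
  constructor
  · intro h
    obtain ⟨x, t, ht, rfl⟩ := (C.collarHeightFn_le_iff (by norm_num) z).1 h.le
    have ht0 : t = 0 := le_antisymm ht.2 ht.1
    subst ht0
    exact ⟨x, (C.apply_zero x).symm⟩
  · rintro ⟨x, rfl⟩
    rw [← C.apply_zero x, C.collarHeightFn_apply x le_rfl, heightProfile_of_le (by norm_num)]

/-- The collar-height function is positive at interior points. [folklore] -/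
theorem collarHeightFn_pos_of_isInteriorPoint' {z : M} (hz : (𝓡∂ (n + 1)).IsInteriorPoint z) :
    0 < C.collarHeightFn z := by
  refine lt_of_le_of_ne (collarHeightFn_nonneg' C z) fun h => ?_
  obtain ⟨x, rfl⟩ := (collarHeightFn_eq_zero_iff' C z).1 h.symm
  exact ((𝓡∂ (n + 1)).isInteriorPoint_iff_not_isBoundaryPoint _).1 hz (b.incl_mem_boundary x)

end Height

/-! ### §3 The signed seam level of Milnor's gluing -/

section SeamLevel

variable {n : ℕ} {M N : Type} [TopologicalSpace M] [ChartedSpace (EuclideanHalfSpace (n + 1)) M]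
  [TopologicalSpace N] [ChartedSpace (EuclideanHalfSpace (n + 1)) N]
  {bM : BoundaryData (𝓡∂ (n + 1)) M (𝓡 n)} {bN : BoundaryData (𝓡∂ (n + 1)) N (𝓡 n)}
  [IsManifold (𝓡∂ (n + 1)) ∞ M] (G : BoundaryGlueData bM bN)

/-- The signed seam level on the first glued manifold `X = (∂M × ℝ) ∪ (M - ∂M)`: the signed profile of
the seam coordinate on the seam piece, the collar height of `G.CM` on the interior of `M`. [folklore] -/
def seamLevel₁ : G.d₁.Glued → ℝ :=
  G.d₁.desc (fun p : bM.carrier × ℝ => signedHeightProfile p.2)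
    (fun x : InteriorManifold (𝓡∂ (n + 1)) M => G.CM.collarHeightFn x.val) fun p hp => by
      have hp' : 0 < p.2 := hp
      show signedHeightProfile p.2 = G.CM.collarHeightFn (G.CM.glueHomeo p).val
      rw [G.CM.glueHomeo_apply_val hp', G.CM.collarHeightFn_apply p.1 hp'.le,
        signedHeightProfile_of_nonneg hp'.le]

/-- `seamLevel₁` on the seam piece (definitional). [folklore] -/
@[simp] theorem seamLevel₁_inl (p : bM.carrier × ℝ) : seamLevel₁ G (G.d₁.inl p) = signedHeightProfile p.2 :=
  rfl

/-- `seamLevel₁` on the interior of `M` (definitional). [folklore] -/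
@[simp] theorem seamLevel₁_inr (x : InteriorManifold (𝓡∂ (n + 1)) M) :
    seamLevel₁ G (G.d₁.inr x) = G.CM.collarHeightFn x.val :=
  rfl

variable [Nonempty bM.carrier] [IsManifold (𝓡∂ (n + 1)) ∞ N]

/-- **The signed seam level of Milnor's gluing `P = M ∪_φ N`**: `seamLevel₁` on `X`, minus the collar
height of `G.CN` on the interior of `N`. [cite: MilnorHCobordism1965, Thm. 1.4] -/
def seamLevelFn : G.d₂.Glued → ℝ :=
  G.d₂.desc (seamLevel₁ G) (fun c : InteriorManifold (𝓡∂ (n + 1)) N => -G.CN.collarHeightFn c.val)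
    fun x hx => by
      obtain ⟨p, hp, rfl⟩ := G.mem_glue₂_source_iff.1 hx
      show seamLevel₁ G (G.d₁.inl p) = -G.CN.collarHeightFn (G.glue₂ (G.d₁.inl p)).val
      have hp' : 0 < -p.2 := by linarith
      rw [G.glue₂_inl, G.CN.inPt_val (p := (G.φ p.1, -p.2)) hp', G.CN.collarHeightFn_apply _ hp'.le,
        seamLevel₁_inl, signedHeightProfile_of_nonpos hp.le]

/-- The seam level on the seam piece: `Φ₀ (ι (z, t)) = signedHeightProfile t` (definitional). [folklore] -/
@[simp] theorem seamLevelFn_inl_inl (p : bM.carrier × ℝ) :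
    seamLevelFn G (G.d₂.inl (G.d₁.inl p)) = signedHeightProfile p.2 :=
  rfl

/-- The seam level on the interior of `N` (definitional). [folklore] -/
@[simp] theorem seamLevelFn_inr (c : InteriorManifold (𝓡∂ (n + 1)) N) :
    seamLevelFn G (G.d₂.inr c) = -G.CN.collarHeightFn c.val :=
  rfl

/-- **`Φ₀ ∘ j_M` is the collar height of `G.CM`.** [folklore] -/
theorem seamLevelFn_jM (a : M) : seamLevelFn G (G.jM a) = G.CM.collarHeightFn a := by
  rcases BoundaryGlueData.exists_incl_or_isInteriorPoint (bM := bM) a with ⟨z, rfl⟩ | ha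
  · rw [G.jM_incl, seamLevelFn_inl_inl, signedHeightProfile_eq_zero_iff.2 rfl, eq_comm,
      collarHeightFn_eq_zero_iff']
    exact ⟨z, rfl⟩
  · rw [G.jM_of_isInteriorPoint ha]
    rfl

/-- **`Φ₀ ∘ j_N` is minus the collar height of `G.CN`.** [folklore] -/
theorem seamLevelFn_jN (c : N) : seamLevelFn G (G.jN c) = -G.CN.collarHeightFn c := by
  rcases BoundaryGlueData.exists_incl_or_isInteriorPoint (bM := bN) c with ⟨w, rfl⟩ | hc
  · rw [G.jN_incl, seamLevelFn_inl_inl, signedHeightProfile_eq_zero_iff.2 rfl, eq_comm, neg_eq_zero,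
      collarHeightFn_eq_zero_iff']
    exact ⟨w, rfl⟩
  · rw [G.jN_of_isInteriorPoint hc]
    rfl

/-- `Φ₀ ≥ 0` on `j_M (M)`. [folklore] -/
theorem seamLevelFn_jM_nonneg (a : M) : 0 ≤ seamLevelFn G (G.jM a) := by
  rw [seamLevelFn_jM]
  exact collarHeightFn_nonneg' _ a

/-- `Φ₀ > 0` at `j_M` of interior points. [folklore] -/
theorem seamLevelFn_jM_pos {a : M} (ha : (𝓡∂ (n + 1)).IsInteriorPoint a) : 0 < seamLevelFn G (G.jM a) := by
  rw [seamLevelFn_jM]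
  exact collarHeightFn_pos_of_isInteriorPoint' _ ha

/-- `Φ₀ (j_M a) = 0 ↔ a ∈ ∂M`. [folklore] -/
theorem seamLevelFn_jM_eq_zero_iff (a : M) : seamLevelFn G (G.jM a) = 0 ↔ ∃ z, bM.incl z = a := by
  rw [seamLevelFn_jM, collarHeightFn_eq_zero_iff']

/-- `Φ₀ ≤ 0` on `j_N (N)`. [folklore] -/
theorem seamLevelFn_jN_nonpos (c : N) : seamLevelFn G (G.jN c) ≤ 0 := by
  rw [seamLevelFn_jN, neg_nonpos]
  exact collarHeightFn_nonneg' _ c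

/-- `Φ₀ < 0` at `j_N` of interior points. [folklore] -/
theorem seamLevelFn_jN_neg {c : N} (hc : (𝓡∂ (n + 1)).IsInteriorPoint c) : seamLevelFn G (G.jN c) < 0 := by
  rw [seamLevelFn_jN, neg_lt_zero]
  exact collarHeightFn_pos_of_isInteriorPoint' _ hc

/-- `Φ₀ (j_N c) = 0 ↔ c ∈ ∂N`. [folklore] -/
theorem seamLevelFn_jN_eq_zero_iff (c : N) : seamLevelFn G (G.jN c) = 0 ↔ ∃ w, bN.incl w = c := by
  rw [seamLevelFn_jN, neg_eq_zero, collarHeightFn_eq_zero_iff']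

/-- **The zero set of `Φ₀` is the seam `ι (∂M × {0})`.** [folklore] -/
theorem seamLevelFn_eq_zero_iff (p : G.d₂.Glued) :
    seamLevelFn G p = 0 ↔ ∃ z, p = G.d₂.inl (G.d₁.inl (z, 0)) := by
  constructor
  · intro hp
    have hcov : p ∈ range G.jM ∪ range G.jN := by rw [G.range_jM_union_range_jN]; exact mem_univ _
    rcases hcov with ⟨a, rfl⟩ | ⟨c, rfl⟩
    · obtain ⟨z, rfl⟩ := (seamLevelFn_jM_eq_zero_iff G a).1 hp
      exact ⟨z, G.jM_incl z⟩
    · obtain ⟨w, rfl⟩ := (seamLevelFn_jN_eq_zero_iff G c).1 hp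
      exact ⟨G.φ.symm w, G.jN_incl w⟩
  · rintro ⟨z, rfl⟩
    rw [seamLevelFn_inl_inl]
    exact signedHeightProfile_eq_zero_iff.2 rfl

/-- **The sign of `Φ₀`**: `Φ₀ p ≥ 0 ↔ p ∈ j_M (M)`. [folklore] -/
theorem seamLevelFn_nonneg_iff (p : G.d₂.Glued) : 0 ≤ seamLevelFn G p ↔ p ∈ range G.jM := by
  constructor
  · intro hp
    have hcov : p ∈ range G.jM ∪ range G.jN := by rw [G.range_jM_union_range_jN]; exact mem_univ _
    rcases hcov with h | ⟨c, rfl⟩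
    · exact h
    · rcases BoundaryGlueData.exists_incl_or_isInteriorPoint (bM := bN) c with ⟨w, rfl⟩ | hc
      · exact ⟨bM.incl (G.φ.symm w), by rw [G.jM_incl, G.jN_incl]⟩
      · exact absurd hp (not_le.2 (seamLevelFn_jN_neg G hc))
  · rintro ⟨a, rfl⟩
    exact seamLevelFn_jM_nonneg G a

/-- **The sign of `Φ₀`**: `Φ₀ p ≤ 0 ↔ p ∈ j_N (N)`. [folklore] -/
theorem seamLevelFn_nonpos_iff (p : G.d₂.Glued) : seamLevelFn G p ≤ 0 ↔ p ∈ range G.jN := by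
  constructor
  · intro hp
    have hcov : p ∈ range G.jM ∪ range G.jN := by rw [G.range_jM_union_range_jN]; exact mem_univ _
    rcases hcov with ⟨a, rfl⟩ | h
    · rcases BoundaryGlueData.exists_incl_or_isInteriorPoint (bM := bM) a with ⟨z, rfl⟩ | ha
      · exact ⟨bN.incl (G.φ z), by rw [G.jM_incl, G.jN_incl, Diffeomorph.symm_apply_apply]⟩
      · exact absurd hp (not_le.2 (seamLevelFn_jM_pos G ha))
    · exact h
  · rintro ⟨c, rfl⟩
    exact seamLevelFn_jN_nonpos G c

variable [T2Space M] [T2Space N] [CompactSpace M] [CompactSpace N]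

/-- **The seam level is smooth** (piecewise on the three open pieces of Milnor's gluing,
`contMDiff_iff_comp_inl_inr` twice). [cite: MilnorHCobordism1965, Thm. 1.4] -/
theorem contMDiff_seamLevelFn :
    ContMDiff 𝓘(ℝ, EuclideanSpace ℝ (Fin (n + 1))) 𝓘(ℝ, ℝ) ∞ (seamLevelFn G) := by
  haveI : CompactSpace bM.carrier := bM.compactSpace_carrier
  haveI : CompactSpace bN.carrier := bN.compactSpace_carrier
  rw [SmoothGlueData.contMDiff_iff_comp_inl_inr]
  refine ⟨?_, ?_⟩
  · show ContMDiff 𝓘(ℝ, EuclideanSpace ℝ (Fin (n + 1))) 𝓘(ℝ, ℝ) ∞ (seamLevel₁ G)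
    rw [SmoothGlueData.contMDiff_iff_comp_inl_inr]
    refine ⟨?_, ?_⟩
    · exact contDiff_signedHeightProfile.contMDiff.comp contMDiff_snd
    · exact G.CM.contMDiff_collarHeightFn.comp InteriorManifold.contMDiff_val
  · show ContMDiff 𝓘(ℝ, EuclideanSpace ℝ (Fin (n + 1))) 𝓘(ℝ, ℝ) ∞
      fun c : InteriorManifold (𝓡∂ (n + 1)) N => -G.CN.collarHeightFn c.val
    exact (G.CN.contMDiff_collarHeightFn.comp InteriorManifold.contMDiff_val).neg

omit [T2Space M] [T2Space N] [CompactSpace M] [CompactSpace N] in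
/-- The seam line `t ↦ ι (z, t)` is smooth. [folklore] -/
theorem contMDiff_seamLine (z : bM.carrier) :
    ContMDiff 𝓘(ℝ, ℝ) 𝓘(ℝ, EuclideanSpace ℝ (Fin (n + 1))) ∞ fun t : ℝ => G.d₂.inl (G.d₁.inl (z, t)) :=
  (G.d₂.contMDiff_inl.comp G.d₁.contMDiff_inl).comp (contMDiff_const.prodMk contMDiff_id)

/-- **The seam is a regular level of `Φ₀`**: along the seam line `t ↦ ι (z, t)` the seam level is
the signed profile, whose derivative at `0` is `1`. [cite: Milnor1963, Thm. 3.1] -/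
theorem not_isMCriticalPt_seamLevelFn (z : bM.carrier) :
    ¬ IsMCriticalPt 𝓘(ℝ, EuclideanSpace ℝ (Fin (n + 1))) (seamLevelFn G) (G.d₂.inl (G.d₁.inl (z, 0))) := by
  intro hc
  have hj : MDifferentiableAt 𝓘(ℝ, ℝ) 𝓘(ℝ, EuclideanSpace ℝ (Fin (n + 1)))
      (fun t : ℝ => G.d₂.inl (G.d₁.inl (z, t))) 0 :=
    (contMDiff_seamLine G z 0).mdifferentiableAt (by simp)
  have hG : MDifferentiableAt 𝓘(ℝ, EuclideanSpace ℝ (Fin (n + 1))) 𝓘(ℝ, ℝ) (seamLevelFn G)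
      ((fun t : ℝ => G.d₂.inl (G.d₁.inl (z, t))) 0) :=
    (contMDiff_seamLevelFn G _).mdifferentiableAt (by simp)
  have heq : (seamLevelFn G ∘ fun t : ℝ => G.d₂.inl (G.d₁.inl (z, t))) =ᶠ[𝓝 0] signedHeightProfile :=
    Filter.Eventually.of_forall fun t => rfl
  exact not_isMCriticalPt_signedHeightProfile_zero (isMCriticalPt_of_comp_of_eventuallyEq hj hG heq hc)

/-- **Every zero of `Φ₀` is a regular point.** [cite: Milnor1963, Thm. 3.1] -/
theorem not_isMCriticalPt_seamLevelFn_of_eq_zero {p : G.d₂.Glued} (hp : seamLevelFn G p = 0) :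
    ¬ IsMCriticalPt 𝓘(ℝ, EuclideanSpace ℝ (Fin (n + 1))) (seamLevelFn G) p := by
  obtain ⟨z, rfl⟩ := (seamLevelFn_eq_zero_iff G p).1 hp
  exact not_isMCriticalPt_seamLevelFn G z

/-- **Registered helper `helper_seamLevel_regular` (sub-goal of `stub_steinRealisation`, T3b (iii),
wave 4, lead c5): Milnor's gluing carries a smooth function, `≥ 0` exactly on `j_M (M)`, `≤ 0`
exactly on `j_N (N)`, all of whose zeros are regular points** (the signed seam level).
[cite: Milnor1963, Thm. 3.1] -/
theorem helper_seamLevel_regular : ∀ {n : ℕ} {M N : Type} [TopologicalSpace M] [ChartedSpace (EuclideanHalfSpace (n + 1)) M] [TopologicalSpace N] [ChartedSpace (EuclideanHalfSpace (n + 1)) N] {bM : Literature.Topology.FourManifolds.BoundaryData (𝓡∂ (n + 1)) M (𝓡 n)} {bN : Literature.Topology.FourManifolds.BoundaryData (𝓡∂ (n + 1)) N (𝓡 n)} [IsManifold (𝓡∂ (n + 1)) ∞ M] [Nonempty bM.carrier] [IsManifold (𝓡∂ (n + 1)) ∞ N] [T2Space M] [T2Space N] [CompactSpace M] [CompactSpace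 N] (G : Literature.Topology.FourManifolds.BoundaryGlueData bM bN), ∃ F : G.d₂.Glued → ℝ, ContMDiff 𝓘(ℝ, EuclideanSpace ℝ (Fin (n + 1))) 𝓘(ℝ, ℝ) ∞ F ∧ (∀ p, 0 ≤ F p ↔ p ∈ Set.range G.jM) ∧ (∀ p, F p ≤ 0 ↔ p ∈ Set.range G.jN) ∧ (∀ p, F p = 0 → ¬ Literature.Topology.FourManifolds.IsMCriticalPt 𝓘(ℝ, EuclideanSpace ℝ (Fin (n + 1))) F p) ∧ (∀ z t, F (G.d₂.inl (G.d₁.inl (z, t))) = Summit.SmoothPoincare4.SmoothPoincare4.Theorems.AcyclicBisectionExists.ModpBraidOrbits.signedHeightProfile t) := by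
  intro n M N _ _ _ _ bM bN _ _ _ _ _ _ _ G
  exact ⟨seamLevelFn G, contMDiff_seamLevelFn G, seamLevelFn_nonneg_iff G, seamLevelFn_nonpos_iff G,
    fun p hp => not_isMCriticalPt_seamLevelFn_of_eq_zero G hp, fun z t => rfl⟩

end SeamLevel

end Summit.SmoothPoincare4.SmoothPoincare4.Theorems.AcyclicBisectionExists.ModpBraidOrbits

end
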